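import Summits.RiemannHypothesis.RiemannHypothesis.Theorems.WeilTwoPrimeDeflM80FBase
import Summits.RiemannHypothesis.RiemannHypothesis.Theorems.WeilTwoPrimeDeflM80FDataR
import Literature.NumberTheory.LFunctions.WeilTwoPrimeCellsT120
import Literature.NumberTheory.LFunctions.WeilTwoPrimeCertificateDeflated
import HarnessLib

/-!
# Deflated two-prime certificate M80F: the certificate `weilCertDeflM80F : WeilCert23` and its augmented coefficient matrix

`weilCertDeflM80F` = base `weilCertDeflM80FBase` + `j = 5` + `pnu = 64` + the cells `weilTwoPrimeCellsT120` + support `b = 4023/5000` + the table `weilCertDeflM80FNu`; penalty data `weilCertDeflM80FR`; `weilCertDeflM80FP = P_r + Σ μ ĉ ĉᵀ`. [cite: Yoshida1992, §6, Thm 1 p. 310] Data only.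
-/

set_option linter.dupNamespace false

noncomputable section

namespace Summit.RiemannHypothesis.RiemannHypothesis.Theorems.EvenWinsBeyondArch

open Literature.NumberTheory.LFunctions

/-- **The deflated two-prime certificate M80F** (`a₀ = b = 4023/5000`, `N = 271`, `T = 120`, `β₂₃ = 17/25`, k_odd = 6). [folklore] -/
def weilCertDeflM80F : WeilCert23 := ⟨weilCertDeflM80FBase, 5, 64, weilTwoPrimeCellsT120, 4023/5000, weilCertDeflM80FNu⟩

/-- The base of `weilCertDeflM80F` is `weilCertDeflM80FBase` (definitional). [folklore] -/
theorem weilCertDeflM80F_base : weilCertDeflM80F.base = weilCertDeflM80FBase := rfl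

/-- The table of `weilCertDeflM80F` is `weilCertDeflM80FNu` (definitional). [folklore] -/
theorem weilCertDeflM80F_nuTab : weilCertDeflM80F.nuTab = weilCertDeflM80FNu := rfl

/-- The augmented coefficient matrix `P_r + Σ μ ĉ ĉᵀ` of certificate M80F. [folklore] -/
def weilCertDeflM80FP (k l : ℕ) : ℚ := weilCertDeflM80FBase.prQ weilCertDeflM80FNu k l + rankOneQ weilCertDeflM80FR k l

/-- `weilCertDeflM80FP` is the augmented matrix of the certificate (definitional). [folklore] -/
theorem weilCertDeflM80FP_eq : weilCertDeflM80FP = fun k l ↦ weilCertDeflM80F.base.prQ weilCertDeflM80F.nuTab k l + rankOneQ weilCertDeflM80FR k l := rfl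

end Summit.RiemannHypothesis.RiemannHypothesis.Theorems.EvenWinsBeyondArch
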